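import Summits.AtomisticToContinuum.Crystallization.Theorems.OverbindingBudgetAffineLayerMainA
import Literature.Analysis.FunctionSpaces.BesselKSmallArgument
import Literature.Algebra.EuclideanLattices.PQCLLLProofs

/-!
# Overbinding budget, affine far-core cell (31280 Z2): LATTICE LINES — exact half-integer `K`, the explicit 1-D Poisson–Bessel identity
# (decomp-a2c lens-4, generation 66, Deliverable H part 1 of 2 = memo NODE-g66 §12, item (T1) planar layer)

Imports g66 F1 `…LayerMainA` (`tsum_inv_pow_shift_eq`: the absolute Poisson–Bessel expansion over an abstract lattice `L ⊂ V`;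
transitively tree `…LayerPoisson(A)`, Literature `DualLattice`), Literature `BesselKSmallArgument` (`besselKReal_half_eq`; transitively
`BesselKRecurrence`: `besselKReal_succ_sub_pred`, `besselKReal_neg`, `besselKReal_le_of_abs_le`) and `PQCLLLProofs`
(`covolume_latticeOfBasis_eq_prod_norm_gramSchmidt`).  Restates nothing.  PROVED, 0 sorry, standard axioms
(probe `TowerTreeG66H.lean` rc 0 over the TREE imports; pins `TowerTreeG66HPins.lean`; must-fail `TowerTreeG66HMustFail.lean`).

WHY (memo §12): after F/G the window sums `T₃↑, T₆↓` are “seven near layers `|k| ≤ 3` + closed form”; the layers `k = ±1, ±2, ±3`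
are rows of the F2 format, but the PLANAR layer `k = 0` (`layerSum B (2σ) 0 0 = Σ'_{(i,j) ≠ 0} ‖i Bt₁ + j Bt₂‖^{−2σ}`, a 2-D Epstein
zeta value) has no height to expand in.  Chowla–Selberg: decompose it into LINES `j = const`; each line `j ≠ 0` is a 1-D shifted
lattice sum at distance `|j|·h_B` from the line `ℝ·Bt₁`, whose Poisson–Bessel expansion has HALF-INTEGER index `σ − ½` — and
`K_{m+½}` is ELEMENTARY.  So the planar layer is an explicit, geometrically convergent double series of `exp`, `cos`, `√` and
rational functions of the Gram entries (part 2 `…PlanarLayer`).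

* §H1 `halfPoly`, `halfPolyQ` (+ `halfPolyQ_cast`), `halfPoly_two` (`1 + 3/y + 3/y²`), `halfPoly_five`, `halfPoly_pos`;
  ★ `besselKReal_half_add_eq` — `K_{m+½}(y) = √(π/(2y)) e^{−y} · halfPoly m y` EXACTLY (DLMF 10.39.2 + 10.29.1 + `K_{−ν} = K_ν`);
  `besselKReal_nat_le_halfPoly` (`K_m ≤ K_{m+½}`).
* §H2 `intLattice` (`ℤ ⊂ ℝ` as the span of the singleton basis), `mem_intLattice_iff`, `covolume_intLattice` (`= 1`),
  `mem_dualLattice_intLattice_iff` (`(ℤ)* = ℤ`), `tsum_intLattice_eq`, `tsum_dualLattice_intLattice_eq`;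
  ★★ `tsum_int_shift_eq` — for `σ ≥ 1`, `c > 0`, `x ∈ ℝ`:
  `Σ_{i∈ℤ} ((i − x)² + c)^{−σ} = (√π/Γσ)·(Γ(σ−½)/c^{σ−½} + 2 Σ_{m∈ℤ} cos(2πxm) (π|m|/√c)^{σ−½} K_{σ−½}(2π√c|m|))`.
* §H3 `norm_sq_int_smul_add_eq` (completing the square along a line), ★★ `tsum_int_line_eq` — for `u ≠ 0`, `⟪p,u⟫² < ‖p‖²‖u‖²`,
  `σ ≥ 1`, `a = ‖u‖²`: `Σ_{i∈ℤ} ‖iu + p‖^{−2σ} = a^{−σ}(√π/Γσ)(Γ(σ−½)/c^{σ−½} + 2Σ_m cos(2π(⟪p,u⟫/a)m)(π|m|/√c)^{σ−½}K_{σ−½}(2π√c|m|))`,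
  `c = (‖p‖²a − ⟪p,u⟫²)/a²`; `inner_sq_lt_of_not_mem_span` (strict Cauchy–Schwarz off the line).
-/

noncomputable section

open MeasureTheory Set Module
open scoped Real InnerProductSpace

namespace Summit.AtomisticToContinuum.Crystallization.Theorems.OverbindingBudgetAffineFarSmoothSplit
-- (landing lane: `Literature.MathematicalPhysics.StatisticalMechanics` is not in this module's import closure — the seat's tower
-- also imported `…HcpFccLatticeSumsLayers`; opening an unknown namespace kills the whole `open`, so it is dropped here.)
open Literature.Algebra.EuclideanLattices Literature.Analysis.FunctionSpaces

/-! ## §H1 Exact half-integer Macdonald functions: `K_{m+1/2}(y) = √(π/(2y)) e^{−y} · halfPoly m y` -/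

section HalfBessel

/-- The polynomial in `1/y` with `K_{m+1/2}(y) = √(π/(2y)) e^{−y} · halfPoly m y`, defined by the three-term
recurrence `K_{ν+1} = K_{ν−1} + (2ν/y) K_ν` (DLMF 10.29.1) started at `K_{1/2} = K_{−1/2}`:
`halfPoly 0 = 1`, `halfPoly 1 = 1 + 1/y`, `halfPoly (m+2) = halfPoly m + ((2m+3)/y) halfPoly (m+1)`.
(`halfPoly m y = Σ_{k ≤ m} (m+k)!/(k!(m−k)!) (2y)^{−k}`, DLMF 10.49.12.) [cite: DLMF, 10.49.12] -/
noncomputable def halfPoly : ℕ → ℝ → ℝ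
  | 0, _ => 1
  | 1, y => 1 + 1 / y
  | (m + 2), y => halfPoly m y + (2 * (m : ℝ) + 3) / y * halfPoly (m + 1) y

/-- Rational mirror of `halfPoly` (for `decide` kernels). -/
def halfPolyQ : ℕ → ℚ → ℚ
  | 0, _ => 1
  | 1, y => 1 + 1 / y
  | (m + 2), y => halfPolyQ m y + (2 * (m : ℚ) + 3) / y * halfPolyQ (m + 1) y

/-- `halfPolyQ_cast` (docstring added by the landing lane; see the module docstring). [formal bookkeeping] -/
theorem halfPolyQ_cast : ∀ (m : ℕ) (y : ℚ), ((halfPolyQ m y : ℚ) : ℝ) = halfPoly m (y : ℝ)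
  | 0, _ => by simp [halfPolyQ, halfPoly]
  | 1, y => by simp [halfPolyQ, halfPoly]
  | (m + 2), y => by
      simp only [halfPolyQ, halfPoly, Rat.cast_add, Rat.cast_mul, Rat.cast_div, Rat.cast_natCast, Rat.cast_ofNat]
      rw [halfPolyQ_cast m y, halfPolyQ_cast (m + 1) y]

/-- `halfPoly_zero` (docstring added by the landing lane; see the module docstring). [formal bookkeeping] -/
@[simp] theorem halfPoly_zero (y : ℝ) : halfPoly 0 y = 1 := rfl
/-- `halfPoly_one` (docstring added by the landing lane; see the module docstring). [formal bookkeeping] -/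
@[simp] theorem halfPoly_one (y : ℝ) : halfPoly 1 y = 1 + 1 / y := rfl
/-- `halfPoly_add_two` (docstring added by the landing lane; see the module docstring). [formal bookkeeping] -/
theorem halfPoly_add_two (m : ℕ) (y : ℝ) :
    halfPoly (m + 2) y = halfPoly m y + (2 * (m : ℝ) + 3) / y * halfPoly (m + 1) y := rfl

/-- `K_{5/2}`: `halfPoly 2 y = 1 + 3/y + 3/y²`. [cite: DLMF, 10.49.12] -/
theorem halfPoly_two {y : ℝ} (hy : y ≠ 0) : halfPoly 2 y = 1 + 3 / y + 3 / y ^ 2 := by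
  rw [halfPoly_add_two, halfPoly_zero, halfPoly_one]; push_cast; field_simp; ring

/-- `K_{11/2}`: `halfPoly 5 y = 1 + 15/y + 105/y² + 420/y³ + 945/y⁴ + 945/y⁵`. [cite: DLMF, 10.49.12] -/
theorem halfPoly_five {y : ℝ} (hy : y ≠ 0) :
    halfPoly 5 y = 1 + 15 / y + 105 / y ^ 2 + 420 / y ^ 3 + 945 / y ^ 4 + 945 / y ^ 5 := by
  rw [show halfPoly 5 y = halfPoly 3 y + (2 * ((3 : ℕ) : ℝ) + 3) / y * halfPoly 4 y from halfPoly_add_two 3 y,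
    show halfPoly 4 y = halfPoly 2 y + (2 * ((2 : ℕ) : ℝ) + 3) / y * halfPoly 3 y from halfPoly_add_two 2 y,
    show halfPoly 3 y = halfPoly 1 y + (2 * ((1 : ℕ) : ℝ) + 3) / y * halfPoly 2 y from halfPoly_add_two 1 y,
    halfPoly_two hy, halfPoly_one]
  push_cast; field_simp; ring

/-- `halfPoly m y > 0` for `y > 0`. -/
theorem halfPoly_pos : ∀ (m : ℕ) {y : ℝ}, 0 < y → 0 < halfPoly m y
  | 0, _, _ => by simp
  | 1, y, hy => by rw [halfPoly_one]; positivity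
  | (m + 2), y, hy => by
      rw [halfPoly_add_two]
      have h0 := halfPoly_pos m hy
      have h1 := halfPoly_pos (m + 1) hy
      positivity

/-- ★ **Exact half-integer Macdonald function**: `K_{m+1/2}(y) = √(π/(2y)) e^{−y} · halfPoly m y` (`y > 0`),
from `K_{1/2}` (DLMF 10.39.2), `K_{−ν} = K_ν` and the recurrence (DLMF 10.29.1). [cite: DLMF, 10.39.2] [cite: DLMF, 10.29.1] -/
theorem besselKReal_half_add_eq : ∀ (m : ℕ) {y : ℝ}, 0 < y →
    besselKReal ((m : ℝ) + 1 / 2) y = Real.sqrt (π / (2 * y)) * Real.exp (-y) * halfPoly m y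
  | 0, y, hy => by rw [Nat.cast_zero, zero_add, besselKReal_half_eq hy, halfPoly_zero, mul_one]
  | 1, y, hy => by
      have h := besselKReal_succ_sub_pred (1 / 2) hy
      rw [show (1 : ℝ) / 2 - 1 = -(1 / 2) by norm_num, besselKReal_neg, sub_eq_iff_eq_add] at h
      rw [show ((1 : ℕ) : ℝ) + 1 / 2 = 1 / 2 + 1 by norm_num, h, besselKReal_half_eq hy, halfPoly_one]
      ring
  | (m + 2), y, hy => by
      have h := besselKReal_succ_sub_pred ((m : ℝ) + 3 / 2) hy
      rw [sub_eq_iff_eq_add] at h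
      have e1 : ((m + 2 : ℕ) : ℝ) + 1 / 2 = (m : ℝ) + 3 / 2 + 1 := by push_cast; ring
      have e2 : (m : ℝ) + 3 / 2 - 1 = (m : ℝ) + 1 / 2 := by ring
      have e3 : (m : ℝ) + 3 / 2 = ((m + 1 : ℕ) : ℝ) + 1 / 2 := by push_cast; ring
      rw [e1, h, e2, besselKReal_half_add_eq m hy, e3, besselKReal_half_add_eq (m + 1) hy, halfPoly_add_two]
      push_cast
      field_simp
      ring

/-- Corollary: `K_m(y) ≤ K_{m+1/2}(y) = √(π/(2y)) e^{−y} halfPoly m y` for integer `m` (DLMF 10.32.9 order monotonicity). -/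
theorem besselKReal_nat_le_halfPoly (m : ℕ) {y : ℝ} (hy : 0 < y) :
    besselKReal m y ≤ Real.sqrt (π / (2 * y)) * Real.exp (-y) * halfPoly m y := by
  rw [← besselKReal_half_add_eq m hy]
  refine besselKReal_le_of_abs_le ?_ hy
  have h0 : (0 : ℝ) ≤ m := Nat.cast_nonneg m
  rw [abs_of_nonneg h0, abs_of_nonneg (by linarith)]
  linarith

end HalfBessel

/-! ## §H2 The explicit one-dimensional Poisson–Bessel identity (lines): `Σ_{i∈ℤ} ((i − x)² + c)^{−σ}` -/

section Line

open Literature.Algebra.EuclideanLattices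

/-- The lattice `ℤ ⊂ ℝ` as the `ℤ`-span of the singleton basis (an `abbrev`: Mathlib's `ZSpan` instances
`DiscreteTopology` / `IsZLattice` apply by unfolding). -/
abbrev intLattice : Submodule ℤ ℝ := Submodule.span ℤ (Set.range ⇑(Module.Basis.singleton (Fin 1) ℝ))

/-- `mem_intLattice_iff` (docstring added by the landing lane; see the module docstring). [formal bookkeeping] -/
theorem mem_intLattice_iff {y : ℝ} : y ∈ intLattice ↔ ∃ i : ℤ, (i : ℝ) = y := by
  rw [Submodule.mem_span_range_iff_exists_fun]
  constructor
  · rintro ⟨cf, hcf⟩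
    refine ⟨cf 0, ?_⟩
    rw [← hcf, Fin.sum_univ_one, Module.Basis.singleton_apply]
    simp
  · rintro ⟨i, rfl⟩
    refine ⟨fun _ => i, ?_⟩
    rw [Fin.sum_univ_one, Module.Basis.singleton_apply]
    simp

/-- `covol(ℤ ⊂ ℝ) = 1`. -/
theorem covolume_intLattice : ZLattice.covolume intLattice = 1 := by
  have h := covolume_latticeOfBasis_eq_prod_norm_gramSchmidt (Module.Basis.singleton (Fin 1) ℝ)
  have h0 : InnerProductSpace.gramSchmidt ℝ (⇑(Module.Basis.singleton (Fin 1) ℝ)) 0 = 1 := by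
    rw [show (0 : Fin 1) = ⊥ from rfl, InnerProductSpace.gramSchmidt_bot]; simp
  rw [Fin.prod_univ_one, h0, norm_one] at h
  exact h

/-- `y ∈ (ℤ ⊂ ℝ)* ↔ y ∈ ℤ`. -/
theorem mem_dualLattice_intLattice_iff {w : ℝ} : w ∈ dualLattice intLattice ↔ ∃ m : ℤ, (m : ℝ) = w := by
  rw [mem_dualLattice]
  constructor
  · intro h
    obtain ⟨n, hn⟩ := h 1 (mem_intLattice_iff.2 ⟨1, by simp⟩)
    exact ⟨n, by rw [hn, Real.inner_apply, mul_one]⟩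
  · rintro ⟨m, rfl⟩ y hy
    obtain ⟨i, rfl⟩ := mem_intLattice_iff.1 hy
    exact ⟨m * i, by rw [Real.inner_apply]; push_cast; ring⟩

/-- Re-indexing the `ℤ ⊂ ℝ` lattice sum by `ℤ`. -/
theorem tsum_intLattice_eq (f : ℝ → ℝ) : ∑' y : intLattice, f (y : ℝ) = ∑' i : ℤ, f i := by
  let φ : ℤ → intLattice := fun i => ⟨(i : ℝ), mem_intLattice_iff.2 ⟨i, rfl⟩⟩
  have hφ : Function.Bijective φ := by
    constructor
    · intro i j h
      have : (i : ℝ) = (j : ℝ) := congrArg Subtype.val h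
      exact_mod_cast this
    · intro y
      obtain ⟨i, hi⟩ := mem_intLattice_iff.1 y.2
      exact ⟨i, Subtype.ext hi⟩
  rw [← (Equiv.ofBijective φ hφ).tsum_eq]
  rfl

/-- Re-indexing the dual sum of `ℤ ⊂ ℝ` by `ℤ`. -/
theorem tsum_dualLattice_intLattice_eq (f : ℝ → ℝ) :
    ∑' w : dualLattice intLattice, f (w : ℝ) = ∑' m : ℤ, f m := by
  let ψ : ℤ → dualLattice intLattice := fun m => ⟨(m : ℝ), mem_dualLattice_intLattice_iff.2 ⟨m, rfl⟩⟩
  have hψ : Function.Bijective ψ := by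
    constructor
    · intro i j h
      have : (i : ℝ) = (j : ℝ) := congrArg Subtype.val h
      exact_mod_cast this
    · intro w
      obtain ⟨m, hm⟩ := mem_dualLattice_intLattice_iff.1 w.2
      exact ⟨m, Subtype.ext hm⟩
  rw [← (Equiv.ofBijective ψ hψ).tsum_eq]
  rfl

/-- ★★ **The one-dimensional Poisson–Bessel identity, explicit** (Chowla–Selberg line expansion): for `σ ≥ 1`,
`c > 0`, `x ∈ ℝ`,
`Σ_{i∈ℤ} ((i − x)² + c)^{−σ} = (√π/Γ(σ)) · (Γ(σ−½)/c^{σ−½} + 2 Σ_{m∈ℤ} cos(2π x m) (π|m|/√c)^{σ−½} K_{σ−½}(2π√c|m|))`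
(the `m = 0` term vanishes; `K_{σ−½}` is ELEMENTARY: `besselKReal_half_add_eq`). Instance `V = ℝ`, `L = ℤ`
(`covol = 1`, `L* = ℤ`) of `tsum_inv_pow_shift_eq`. [this file] -/
theorem tsum_int_shift_eq (σ : ℕ) (hσ : 1 ≤ σ) {c : ℝ} (hc : 0 < c) (x : ℝ) :
    ∑' i : ℤ, ((((i : ℝ) - x) ^ 2 + c) ^ σ)⁻¹ =
      Real.sqrt π / Real.Gamma σ *
        (Real.Gamma ((σ : ℝ) - 1 / 2) / c ^ ((σ : ℝ) - 1 / 2) +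
          2 * ∑' m : ℤ, Real.cos (2 * π * x * m) *
            ((π * |(m : ℝ)| / Real.sqrt c) ^ ((σ : ℝ) - 1 / 2) *
              besselKReal ((σ : ℝ) - 1 / 2) (2 * π * Real.sqrt c * |(m : ℝ)|))) := by
  have hrank : Module.finrank ℝ ℝ = 1 := Module.finrank_self ℝ
  have hσ' : Module.finrank ℝ ℝ < 2 * σ := by rw [hrank]; omega
  have h := tsum_inv_pow_shift_eq intLattice σ hσ' hc x
  rw [hrank, covolume_intLattice] at h
  simp only [Nat.cast_one, pow_one, mul_one] at h
  rw [tsum_intLattice_eq (fun y => ((‖y - x‖ ^ 2 + c) ^ σ)⁻¹),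
    tsum_dualLattice_intLattice_eq (fun w => Real.cos (2 * π * ⟪x, w⟫_ℝ) *
      ((π * ‖w‖ / Real.sqrt c) ^ ((σ : ℝ) - 1 / 2) * besselKReal ((σ : ℝ) - 1 / 2) (2 * π * Real.sqrt c * ‖w‖)))] at h
  simp only [Real.norm_eq_abs, sq_abs, Real.inner_apply] at h
  rw [h]
  congr 1; congr 1; congr 1
  refine tsum_congr fun m => ?_
  simp only [mul_assoc]

end Line

/-! ## §H3 A lattice LINE in a Euclidean space: `Σ_{i∈ℤ} ‖i u + p‖^{−2σ}` explicitly -/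

section LineE

variable {E : Type*} [NormedAddCommGroup E] [InnerProductSpace ℝ E]

/-- Completing the square along a line: `‖i u + p‖² = ‖u‖² ((i + ⟪p,u⟫/‖u‖²)² + (‖p‖²‖u‖² − ⟪p,u⟫²)/‖u‖⁴)`. -/
theorem norm_sq_int_smul_add_eq {u : E} (hu : u ≠ 0) (p : E) (i : ℤ) :
    ‖(i : ℝ) • u + p‖ ^ 2 =
      ‖u‖ ^ 2 * ((((i : ℝ) - -(⟪p, u⟫_ℝ / ‖u‖ ^ 2)) ^ 2 +
        (‖p‖ ^ 2 * ‖u‖ ^ 2 - ⟪p, u⟫_ℝ ^ 2) / (‖u‖ ^ 2) ^ 2)) := by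
  have ha : ‖u‖ ^ 2 ≠ 0 := by positivity
  rw [norm_add_sq_real, norm_smul, mul_pow, Real.norm_eq_abs, sq_abs, real_inner_smul_left,
    real_inner_comm p u]
  field_simp
  ring

/-- ★★ **A lattice line, explicit** (`u ≠ 0`, `p` off the line `ℝu`, `σ ≥ 1`; `a = ‖u‖²`, `s = ⟪p,u⟫/a`,
`c = (‖p‖²a − ⟪p,u⟫²)/a² = dist(p, ℝu)²/a`):
`Σ_{i∈ℤ} ‖iu + p‖^{−2σ} = a^{−σ} (√π/Γσ) (Γ(σ−½)/c^{σ−½} + 2 Σ_{m∈ℤ} cos(2π s m) (π|m|/√c)^{σ−½} K_{σ−½}(2π√c|m|))`,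
with `K_{σ−½}` elementary (`besselKReal_half_add_eq`). The `j ≠ 0` lines of the planar layer `k = 0` and
Chowla–Selberg's expansion are this identity with `u = B t₁`, `p = j·B t₂`. [this file] -/
theorem tsum_int_line_eq (σ : ℕ) (hσ : 1 ≤ σ) {u p : E} (hu : u ≠ 0)
    (hp : ⟪p, u⟫_ℝ ^ 2 < ‖p‖ ^ 2 * ‖u‖ ^ 2) :
    ∑' i : ℤ, ((‖(i : ℝ) • u + p‖ ^ 2) ^ σ)⁻¹ =
      ((‖u‖ ^ 2) ^ σ)⁻¹ * (Real.sqrt π / Real.Gamma σ *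
        (Real.Gamma ((σ : ℝ) - 1 / 2) /
            ((‖p‖ ^ 2 * ‖u‖ ^ 2 - ⟪p, u⟫_ℝ ^ 2) / (‖u‖ ^ 2) ^ 2) ^ ((σ : ℝ) - 1 / 2) +
          2 * ∑' m : ℤ, Real.cos (2 * π * (⟪p, u⟫_ℝ / ‖u‖ ^ 2) * m) *
            ((π * |(m : ℝ)| / Real.sqrt ((‖p‖ ^ 2 * ‖u‖ ^ 2 - ⟪p, u⟫_ℝ ^ 2) / (‖u‖ ^ 2) ^ 2)) ^
                ((σ : ℝ) - 1 / 2) *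
              besselKReal ((σ : ℝ) - 1 / 2)
                (2 * π * Real.sqrt ((‖p‖ ^ 2 * ‖u‖ ^ 2 - ⟪p, u⟫_ℝ ^ 2) / (‖u‖ ^ 2) ^ 2) *
                  |(m : ℝ)|)))) := by
  have ha : 0 < ‖u‖ ^ 2 := by positivity
  have hc : 0 < (‖p‖ ^ 2 * ‖u‖ ^ 2 - ⟪p, u⟫_ℝ ^ 2) / (‖u‖ ^ 2) ^ 2 :=
    div_pos (by linarith) (by positivity)
  have hterm : ∀ i : ℤ, ((‖(i : ℝ) • u + p‖ ^ 2) ^ σ)⁻¹ =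
      ((‖u‖ ^ 2) ^ σ)⁻¹ * ((((i : ℝ) - -(⟪p, u⟫_ℝ / ‖u‖ ^ 2)) ^ 2 +
        (‖p‖ ^ 2 * ‖u‖ ^ 2 - ⟪p, u⟫_ℝ ^ 2) / (‖u‖ ^ 2) ^ 2) ^ σ)⁻¹ := by
    intro i
    rw [norm_sq_int_smul_add_eq hu p i, mul_pow, mul_inv]
  have hcos : ∀ m : ℤ, Real.cos (2 * π * -(⟪p, u⟫_ℝ / ‖u‖ ^ 2) * (m : ℝ)) =
      Real.cos (2 * π * (⟪p, u⟫_ℝ / ‖u‖ ^ 2) * m) := fun m => by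
    rw [← Real.cos_neg]; congr 1; ring
  rw [tsum_congr hterm]
  rw [tsum_mul_left, tsum_int_shift_eq σ hσ hc]
  simp_rw [hcos]

/-- The off-line condition from non-collinearity: `p ∉ ℝu ⇒ ⟪p,u⟫² < ‖p‖²‖u‖²` (strict Cauchy–Schwarz). -/
theorem inner_sq_lt_of_not_mem_span {u p : E} (hu : u ≠ 0) (hp : p ∉ Submodule.span ℝ ({u} : Set E)) :
    ⟪p, u⟫_ℝ ^ 2 < ‖p‖ ^ 2 * ‖u‖ ^ 2 := by
  have hle : ⟪p, u⟫_ℝ ^ 2 ≤ ‖p‖ ^ 2 * ‖u‖ ^ 2 := by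
    have h1 := abs_real_inner_le_norm p u
    have h2 : 0 ≤ |⟪p, u⟫_ℝ| := abs_nonneg _
    nlinarith [h1, h2, norm_nonneg p, norm_nonneg u, sq_abs ⟪p, u⟫_ℝ]
  refine lt_of_le_of_ne hle fun heq => hp ?_
  -- equality in Cauchy–Schwarz forces collinearity
  by_cases hp0 : p = 0
  · rw [hp0]; exact Submodule.zero_mem _
  have hpu : 0 < ‖p‖ * ‖u‖ := by
    have : 0 < ‖p‖ := norm_pos_iff.2 hp0
    have : 0 < ‖u‖ := norm_pos_iff.2 hu
    positivity
  have hcs : |⟪p, u⟫_ℝ| = ‖p‖ * ‖u‖ := by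
    have : |⟪p, u⟫_ℝ| ^ 2 = (‖p‖ * ‖u‖) ^ 2 := by rw [sq_abs, heq]; ring
    exact (sq_eq_sq₀ (abs_nonneg _) hpu.le).1 this
  have h1 : |⟪p, u⟫_ℝ / (‖p‖ * ‖u‖)| = 1 := by
    rw [abs_div, abs_of_pos hpu, hcs, div_self hpu.ne']
  obtain ⟨-, r, hr, hur⟩ := (abs_real_inner_div_norm_mul_norm_eq_one_iff p u).1 h1
  rw [Submodule.mem_span_singleton]
  exact ⟨r⁻¹, by rw [hur, smul_smul, inv_mul_cancel₀ hr, one_smul]⟩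

end LineE

end Summit.AtomisticToContinuum.Crystallization.Theorems.OverbindingBudgetAffineFarSmoothSplit

end
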